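import Summits.NavierStokesRegularity.FluidComputer.PalasekTowerReforce
import Summits.NavierStokesRegularity.NavierStokesRegularity.Theses.PalasekTowerBreakdown

/-! # BC3 birth skeleton (v2, TUNED) for the crux `EpisodeBaseT` (item stmt-NavierStokesRegularity-20303)

v2 (2026-08-27, DIRECTOR-NS g8 #48 (4)): v1 (e230e3fa74038bad) was WRITTEN to `Cruxes/EpisodeBaseT/Lines/birth.lean` but the
skeleton audit answered `skeleton.extra-hypothesis`: the audit takes SOME theorem of the file concluding the crux by name and admits as
its hypotheses only REGISTERED obligations by head name (route items / tagged conjectures / the declared `stub_*`), and v1's curried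
`EpisodeBaseT_of : HostPreparationT → FirstEpisodeRT → EpisodeBaseT` had the two LOCAL stub statements as binders. v2 therefore has
EXACTLY ONE theorem concluding the route decl — the hypothesis-free composition `EpisodeBaseT_of` built from the two declared stubs
(sorries live only inside `stub_*`) — and keeps the curried implication as `episodeBaseGAt_tuned_of_stubs`, concluding the UNFOLDED tree
name `EpisodeBaseGAt TowerRates.tuned` (documentation; not a skeleton candidate). Stub statements are byte-identical to v1, so the v1
per-stub probes (stub → crux, stub → S: FAIL 4/4) stand.

`EpisodeBaseT := EpisodeBaseGAt TowerRates.tuned` (route `PalasekTowerBreakdown` rev 19, RE-BASE D-0014 / DIRECTOR-NS #45;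
`TowerRates.tuned = (2^24, 33/32, 12/5, 49/20)`, p517439). This is the port BY SUBSTITUTION `wide ↦ tuned` of the registered
wide skeleton v2 of the aside `EpisodeBase` (`Cruxes/EpisodeBase/Lines/birth.lean`, planner g17): the vocabulary it uses
(`Schedule R`, `Stage ν R S m k`, `Margins.routeG R`, `Schedule.Pins/Rigid/Quiet`, `Schedule.reforce`) is `R`-generic.
Two registered stubs and the kernel-checked composition concluding the ROUTE DECL BY NAME
(`Summit.NavierStokesRegularity.NavierStokesRegularity.Theses.PalasekTowerBreakdown.EpisodeBaseT`):

* `stub_host_preparationT` — HOST PREPARATION AT `tuned` (∃-form; the tuned analogue of `RungG 0` = `hostPreparation`,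
  PROVED at wide in `PalasekTowerHostPreparation.lean` from wide numerics; at tuned it is the target of ecbridge-3 g8's
  L1/L2 `BoxScheduleAt` / `HostScheduleAt` / `LevelZeroDataAt R`, STATUS 2026-08-27 l.9190 / planner word l.≈9249):
  some pinned (`Λ = 8`, `θ = 6/5`), rigid, quiet schedule on the tuned rates carries a globally anchored registered
  stage at LEVEL 0;
* `stub_first_episodeRT` — the FIRST EPISODE IN RE-FORCING FORM at `tuned` (the ∀S-with-S's-own-force form is the
  silent-tail trap at level 0 — `FirstEpisode` REFUTED at wide, p449106 — because `Pins`/`Rigid`/`Quiet` and a level-0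
  `Stage` do not read the force after `τ 0`): for EVERY registered level-0 host `s₀` of a pinned rigid quiet tuned `S`
  there is SOME admissible window force `g` (Clay class, silent from `T`, `push_small`), equal to `S.f` on `[0, τ 0]`, such
  that `S.reforce g …` is again pinned, rigid and quiet and carries a registered LEVEL-1 stage whose velocity agrees with
  `s₀` on `[0, τ 0]` — the prover CHOOSES the push after seeing the host (Palasek's first episode is forced, Rem. 1.4). This
  is the load-bearing stub: the free-run / pushed-run EXISTENCE face inside window 0 (= 169.8 level-0 strain times at
  tuned, Re₀ ≈ 776); the door theorems of record (p515004 near-free-run door, p523959 mechanism-free-run door) are typed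
  at wide and reach this stub at tuned only through ecbridge-3's R-generic door chain L1–L4.

WHAT THIS IS NOT: not NS; nothing decided; two `sorry`s = two stubs. Cell `ns-blowup`, planner g23 (tenure, PTB). -/

namespace Summit.NavierStokesRegularity.FluidComputer.PalasekTowerClayBridge.BirthEpisodeBaseT

open Set MeasureTheory Filter Topology Function Real
open scoped ENNReal ContDiff NNReal
open Literature.Analysis.FluidPDE

/-- the v2.3′ route margin at the tuned rates: strain floors ∧ (GLOBAL anchor ∧ (rigidity ∧ core ledger)) -/
abbrev mGT : Margins TowerRates.tuned := Margins.routeG TowerRates.tuned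

/-- Stub statement (HOST PREPARATION at `tuned`, ∃-form). -/
def HostPreparationT : Prop :=
  ∃ S : Schedule TowerRates.tuned, S.Pins 8 (6 / 5) ∧ S.Rigid ∧ S.Quiet ∧
    Nonempty (Stage 1 TowerRates.tuned S mGT 0)

/-- Stub statement (FIRST EPISODE at `tuned`, RE-FORCING form): every registered level-0 host can be PUSHED to a
registered level-1 stage by some admissible window force agreeing with the schedule's force up to `τ 0`. -/
def FirstEpisodeRT : Prop :=
  ∀ S : Schedule TowerRates.tuned, S.Pins 8 (6 / 5) → S.Rigid → S.Quiet →
    ∀ s₀ : Stage 1 TowerRates.tuned S mGT 0,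
      ∃ (g : ℝ → EuclideanSpace ℝ (Fin 3) → EuclideanSpace ℝ (Fin 3))
        (h₁ : IsSmoothOnHalfSpace g) (h₂ : HasRapidSpaceTimeDecay g)
        (h₃ : ∀ t, S.T ≤ t → ∀ x, g t x = 0)
        (h₄ : ∀ k, ∀ t ∈ Icc (S.τ k) (S.τ (k + 1)), ∀ x, ‖g t x‖ ≤ S.c₄ * TowerRates.tuned.Y k),
        (∀ t ∈ Icc 0 (S.τ 0), ∀ x, g t x = S.f t x) ∧
        (S.reforce g h₁ h₂ h₃ h₄).Pins 8 (6 / 5) ∧ (S.reforce g h₁ h₂ h₃ h₄).Rigid ∧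
        (S.reforce g h₁ h₂ h₃ h₄).Quiet ∧
        ∃ s₁ : Stage 1 TowerRates.tuned (S.reforce g h₁ h₂ h₃ h₄) mGT 1,
          ∀ t ∈ Icc 0 (S.τ 0), s₁.u t = s₀.u t

/-- registered stub: host preparation at the tuned rates. -/
theorem stub_host_preparationT : HostPreparationT := by
  sorry

/-- registered stub: the first episode at the tuned rates, re-forcing form (load-bearing). -/
theorem stub_first_episodeRT : FirstEpisodeRT := by
  sorry

/-- The curried implication (kernel-checked, no `sorry`): host preparation + re-forced first episode ⇒ the crux's
UNFOLDED tree statement `EpisodeBaseGAt TowerRates.tuned` (take the host's schedule and level-0 stage, re-force; the level-1 stage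
of the re-forced schedule is the witness). Not a skeleton candidate (it does not conclude the route decl by name). -/
theorem episodeBaseGAt_tuned_of_stubs : HostPreparationT → FirstEpisodeRT → EpisodeBaseGAt TowerRates.tuned := by
  rintro ⟨S, hP, hR, hQ, ⟨s₀⟩⟩ hF
  obtain ⟨g, h₁, h₂, h₃, h₄, -, hP', hR', hQ', s₁, -⟩ := hF S hP hR hQ s₀
  exact ⟨S.reforce g h₁ h₂ h₃ h₄, hP', hR', hQ', ⟨s₁⟩⟩

/-- **The skeleton (the ONLY theorem of this file concluding the route's crux `EpisodeBaseT` BY NAME)**: the crux from the two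
declared stubs through `episodeBaseGAt_tuned_of_stubs` (carries the stubs' `sorry`s — decoration, not closure evidence). -/
theorem EpisodeBaseT_of :
    Summit.NavierStokesRegularity.NavierStokesRegularity.Theses.PalasekTowerBreakdown.EpisodeBaseT :=
  episodeBaseGAt_tuned_of_stubs stub_host_preparationT stub_first_episodeRT

end Summit.NavierStokesRegularity.FluidComputer.PalasekTowerClayBridge.BirthEpisodeBaseT
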